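import Summits.Parity.BatemanHorn.Theorems.AlmostPrimeZerosDiscMajorantLogGrowingDiscXWide
import Summits.Parity.BatemanHorn.Theorems.AlmostPrimeZerosDiscMajorantLogGrowingDiscXAdd
import Summits.Parity.BatemanHorn.Theorems.AlmostPrimeZerosDiscMajorantLogApTwistedEulerDataSharp
import Summits.Parity.BatemanHorn.Theorems.AlmostPrimeZerosDiscMajorantLogApHolRieszBoundThinWide
import Summits.Parity.BatemanHorn.Theorems.AlmostPrimeZerosDiscMajorantLogApCharBoundSharp
import Summits.Parity.BatemanHorn.Theorems.AlmostPrimeZerosDiscMajorantLogGrowingDiscLinearAP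
import HarnessLib

/-!
# Crux `DiscMajorantLog` (stmt-Parity-17114), line `Sketch`: the complete class `k = 1`, `deg = 1`
on the growing disc (registered stub `stub_growingDiscLinearOfParts` and its unconditional composition)

Crux `Summit.Parity.BatemanHorn.Theses.AlmostPrimeZeros.DiscMajorantLog`: for every Bateman–Horn system
`f`, `‖Σ_{0≤n≤x} z^{s_f(n)}‖ ≤ A·x·(log x)^{k(Re z−1)}·e^{C‖z−1‖log(‖z−1‖+2)}` on the growing disc
`‖z − 1‖ ≤ 3 log log x`.  This file CLOSES the crux's classical class — every system with `k = 1` and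
`deg f = 1`, i.e. `f = (aX + b)` irreducible with `a ≥ 1`, `gcd(a, b) = 1` — at the crux's own constants
(growing radius, Γ-budget), composing BY NAME the stubs landed for the line in wave 1 of lead c1:

* monic `X + c`: `stub_growingDiscXAddOfWide` (p147196) fed with `stub_growingDiscXWide` (p147027; the
  first lead's E1–E4 engine at radius `3 log log x + 3`);
* `aX + b`, `a ≥ 2` (class linₐ): `stub_growingDiscLinearOfCharBound` (p147350: reindexing to the
  progression `m ≡ b (mod a)` and Dirichlet characters) fed with the per-character sharp bound
  `stub_apCharBoundSharpOfParts` (p147327: de-smoothing, the `ζ^z` engine for `χ₀`, the pole-free engine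
  for `χ ≠ χ₀`) and its two engine inputs `stub_apTwistedEulerDataSharp` (p147112: twisted capped Euler
  product on `σ > 1 − 1/(4(R+1))`, budget `e^{b(1+R)log(R+2)}`) and `stub_apHolRieszBoundThinWide`
  (p149882: Landau's pole-free contour on `zfr(c/(R+1))`, range `R ≤ 4 log log x + 4`).

So, with the earlier cells (`k = 0` p140771; `f = X` p144724), the crux is a THEOREM for every system with
`k ≤ 1`, `deg ≤ 1`; what remains open is exactly `k ≥ 2` or some `deg f_i ≥ 2` off the positive real axis
and at growing real `t` (the line's three composition stubs `stub_rightOffAxis`,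
`stub_leftHalfDiscMajorantLog`, `stub_realAxisGrowing`).

References: H. L. Montgomery, R. C. Vaughan, *Multiplicative Number Theory I*, CUP 2007, §7.4
(Theorems 7.17–7.18), §11.3; G. Tenenbaum, *Introduction to analytic and probabilistic number theory*,
3rd ed., II.5 Thm 5.2; A. Selberg, J. Indian Math. Soc. 18 (1954).
-/

noncomputable section

namespace Summit.Parity.BatemanHorn.Cruxes.DiscMajorantLog.Sketch

open scoped BigOperators
open Polynomial

/-- **Registered stub `stub_growingDiscLinearOfParts`** (the cell `f = aX + b`, `a ≥ 2`, `gcd(a,b) = 1`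
on the growing disc, from the sharp twisted Euler data and the thin-wide pole-free engine): composition of
`stub_growingDiscLinearOfCharBound` with `stub_apCharBoundSharpOfParts`.
[cite: MontgomeryVaughan2007, §7.4 Theorems 7.17–7.18 and §11.3] -/
theorem stub_growingDiscLinearOfParts :
    (∀ (q : ℕ) [NeZero q] (χ : DirichletCharacter ℂ q), ∃ b : ℝ, 0 ≤ b ∧ ∀ R : ℝ, 0 ≤ R → ∀ z : ℂ, ‖z‖ ≤ R →
      ∃ G : ℂ → ℂ, DifferentiableOn ℂ G {s : ℂ | 1 / 2 < s.re} ∧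
        (∀ s : ℂ, 1 - 1 / (4 * (R + 1)) < s.re → ‖G s‖ ≤ Real.exp (b * (1 + R) * Real.log (R + 2))) ∧
        (∀ σ : ℝ, 1 < σ →
          LSeriesSummable (fun n : ℕ => χ (n : ZMod q) * z ^ (n.factorization.sum fun _ v => min v 2)) σ) ∧
        (∀ s : ℂ, 1 < s.re →
          LSeries (fun n : ℕ => χ (n : ZMod q) * z ^ (n.factorization.sum fun _ v => min v 2)) s =
            Complex.exp (z * ∑' p : Nat.Primes, -Complex.log (1 - χ ((p : ℕ) : ZMod q) * ((p : ℕ) : ℂ) ^ (-s))) * G s) ∧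
        (∀ σ : ℝ, 1 < σ → σ ≤ 2 →
          ∑' n : ℕ, ‖LSeries.term (fun n : ℕ => χ (n : ZMod q) * z ^ (n.factorization.sum fun _ v => min v 2)) σ n‖ ≤
            Real.exp (b * (1 + R) * Real.log (R + 2)) / (σ - 1) ^ R) ∧
        (χ = 1 → Literature.NumberTheory.LFunctions.SelbergDelange.RieszData R (1 - 1 / (4 * (R + 1)))
          (Real.exp (b * (1 + R) * Real.log (R + 2))) z
          (fun n : ℕ => χ (n : ZMod q) * z ^ (n.factorization.sum fun _ v => min v 2))
          (fun s : ℂ => G s * Complex.exp (z * ∑ p ∈ q.primeFactors, Complex.log (1 - ((p : ℕ) : ℂ) ^ (-s)))))) →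
    (∀ (c K : ℝ), 0 < c → 1 ≤ K → ∃ X₀ : ℝ, ∀ (R B : ℝ) (a : ℕ → ℂ) (F : ℂ → ℂ), 1 ≤ R → 0 ≤ B →
      DifferentiableOn ℂ F (Literature.NumberTheory.LFunctions.ClassicalPsiData.zfr (c / (R + 1))) →
      (∀ s ∈ Literature.NumberTheory.LFunctions.ClassicalPsiData.zfr (c / (R + 1)),
        ‖F s‖ ≤ B * (K * Real.log (|s.im| + 4)) ^ R) →
      (∀ σ : ℝ, 1 < σ → LSeriesSummable a σ) →
      (∀ s : ℂ, 1 < s.re → LSeries a s = F s) →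
      (∀ σ : ℝ, 1 < σ → σ ≤ 2 → ∑' n : ℕ, ‖LSeries.term a σ n‖ ≤ B / (σ - 1) ^ R) →
      ∀ x : ℝ, X₀ ≤ x → R ≤ 4 * Real.log (Real.log x) + 4 →
        ‖∑ n ∈ Finset.Ioc 0 ⌊x⌋₊, a n * ((x : ℂ) - n)‖ ≤
          x ^ 2 * Real.log x ^ (-R) * Real.exp (-(Real.log (Real.log x)) ^ 3) * B) →
    ∀ (a b : ℤ), 2 ≤ a → IsCoprime a b →
      ∃ A C : ℝ, ∃ x₀ : ℕ, ∀ x : ℕ, x₀ ≤ x → ∀ z : ℂ, ‖z - 1‖ ≤ 3 * Real.log (Real.log (x : ℝ)) →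
        ‖(∑ n ∈ Finset.range (x + 1), (z : ℂ) ^ (∑ i, ((((![Polynomial.C a * Polynomial.X + Polynomial.C b] :
            Fin 1 → Polynomial ℤ) i).eval (n : ℤ)).toNat.factorization.sum fun _ v => min v 2)))‖ ≤
          A * (x : ℝ) * (Real.log (x : ℝ)) ^ (((1 : ℕ) : ℝ) * ((z : ℂ).re - 1)) *
            Real.exp (C * ‖(z : ℂ) - 1‖ * Real.log (‖(z : ℂ) - 1‖ + 2)) :=
  fun h3 h4 => stub_growingDiscLinearOfCharBound (stub_apCharBoundSharpOfParts h3 h4)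

/-- **The cell `f = aX + b`, `a ≥ 2`, `gcd(a, b) = 1` (class linₐ), unconditionally**: the parts fed in
by name (`stub_apTwistedEulerDataSharp`, `stub_apHolRieszBoundThinWide`).
[cite: MontgomeryVaughan2007, §7.4 Theorems 7.17–7.18 and §11.3] -/
theorem growingDiscLinearAP :
    ∀ (a b : ℤ), 2 ≤ a → IsCoprime a b →
      ∃ A C : ℝ, ∃ x₀ : ℕ, ∀ x : ℕ, x₀ ≤ x → ∀ z : ℂ, ‖z - 1‖ ≤ 3 * Real.log (Real.log (x : ℝ)) →
        ‖(∑ n ∈ Finset.range (x + 1), (z : ℂ) ^ (∑ i, ((((![Polynomial.C a * Polynomial.X + Polynomial.C b] :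
            Fin 1 → Polynomial ℤ) i).eval (n : ℤ)).toNat.factorization.sum fun _ v => min v 2)))‖ ≤
          A * (x : ℝ) * (Real.log (x : ℝ)) ^ (((1 : ℕ) : ℝ) * ((z : ℂ).re - 1)) *
            Real.exp (C * ‖(z : ℂ) - 1‖ * Real.log (‖(z : ℂ) - 1‖ + 2)) :=
  stub_growingDiscLinearOfParts stub_apTwistedEulerDataSharp stub_apHolRieszBoundThinWide

/-- **Every monic linear system `X + c` on the growing disc, unconditionally**
(`stub_growingDiscXAddOfWide stub_growingDiscXWide`). [cite: MontgomeryVaughan2007, §7.4 Theorems 7.17–7.18] -/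
theorem growingDiscXAdd :
    ∀ c : ℤ, ∃ A C : ℝ, ∃ x₀ : ℕ, ∀ x : ℕ, x₀ ≤ x → ∀ z : ℂ, ‖z - 1‖ ≤ 3 * Real.log (Real.log (x : ℝ)) →
      ‖(∑ n ∈ Finset.range (x + 1), (z : ℂ) ^ (∑ i, ((((![Polynomial.X + Polynomial.C c] : Fin 1 → Polynomial ℤ) i).eval
          (n : ℤ)).toNat.factorization.sum fun _ v => min v 2)))‖ ≤
        A * (x : ℝ) * (Real.log (x : ℝ)) ^ (((1 : ℕ) : ℝ) * ((z : ℂ).re - 1)) *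
          Real.exp (C * ‖(z : ℂ) - 1‖ * Real.log (‖(z : ℂ) - 1‖ + 2)) :=
  stub_growingDiscXAddOfWide stub_growingDiscXWide

namespace GrowingDiscLinear

/-- A degree-one member of a Bateman–Horn system is `aX + b` with `a = leadingCoeff ≥ 1` and
`gcd(a, b) = 1` (an irreducible non-constant integer polynomial is primitive). -/
theorem linear_data {f : Fin 1 → ℤ[X]} (hf : Literature.NumberTheory.Sieve.IsBatemanHornSystem f)
    (hdeg : (f 0).natDegree = 1) :
    f 0 = C ((f 0).coeff 1) * X + C ((f 0).coeff 0) ∧ 1 ≤ (f 0).coeff 1 ∧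
      IsCoprime ((f 0).coeff 1) ((f 0).coeff 0) := by
  have hf0 : f 0 = C ((f 0).coeff 1) * X + C ((f 0).coeff 0) :=
    eq_X_add_C_of_natDegree_le_one hdeg.le
  have hlc : (f 0).leadingCoeff = (f 0).coeff 1 := by rw [Polynomial.leadingCoeff, hdeg]
  have ha : 1 ≤ (f 0).coeff 1 := by
    have := hf.leadingCoeff_pos 0; rw [hlc] at this; omega
  refine ⟨hf0, ha, ?_⟩
  have hprim : (f 0).IsPrimitive :=
    (hf.irreducible 0).isPrimitive (by rw [hdeg]; exact one_ne_zero)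
  rw [Int.isCoprime_iff_gcd_eq_one]
  set a : ℤ := (f 0).coeff 1 with hadef
  set b : ℤ := (f 0).coeff 0 with hbdef
  obtain ⟨a', ha'⟩ := Int.gcd_dvd_left a b
  obtain ⟨b', hb'⟩ := Int.gcd_dvd_right a b
  have hd : C ((Int.gcd a b : ℕ) : ℤ) ∣ f 0 := by
    refine ⟨C a' * X + C b', ?_⟩
    have e1 : C a = C ((Int.gcd a b : ℕ) : ℤ) * C a' := by rw [← map_mul, ← ha']
    have e2 : C b = C ((Int.gcd a b : ℕ) : ℤ) * C b' := by rw [← map_mul, ← hb']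
    rw [hf0, e1, e2]
    ring
  have hu : IsUnit ((Int.gcd a b : ℕ) : ℤ) := Polynomial.isPrimitive_iff_isUnit_of_C_dvd.mp hprim _ hd
  rw [Int.ofNat_isUnit, Nat.isUnit_iff] at hu
  exact hu

/-- The crux exponent of a `Fin 1`-system is that of `![f 0]`, whatever presentation of `f 0` is used. -/
theorem exponent_fin_one (f : Fin 1 → ℤ[X]) (P : ℤ[X]) (hP : f 0 = P) (n : ℕ) :
    (∑ i, (((f i).eval (n : ℤ)).toNat.factorization.sum fun _ v => min v 2)) =
      ∑ i, ((((![P] : Fin 1 → Polynomial ℤ) i).eval (n : ℤ)).toNat.factorization.sum fun _ v => min v 2) := by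
  simp only [Fin.sum_univ_one, Matrix.cons_val_fin_one, hP]

end GrowingDiscLinear

open GrowingDiscLinear in
/-- **The complete class `k = 1`, `deg = 1` of the crux `DiscMajorantLog`.**  For every Bateman–Horn
system `f = (f₀)` with `deg f₀ = 1` there are `A, C, x₀` with
`‖Σ_{0≤n≤x} z^{s_f(n)}‖ ≤ A·x·(log x)^{Re z − 1}·exp(C‖z−1‖ log(‖z−1‖+2))` for all `x ≥ x₀` and all
`‖z − 1‖ ≤ 3 log log x` — the crux's body at `k = 1` verbatim (exponent `((1 : ℕ) : ℝ)·(Re z − 1)`).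
Case `a = 1`: `growingDiscXAdd`; case `a ≥ 2`: `growingDiscLinearAP` with `gcd(a,b) = 1` from
`linear_data`. [cite: MontgomeryVaughan2007, §7.4 Theorems 7.17–7.18 and §11.3] -/
theorem growingDiscLinear :
    ∀ (f : Fin 1 → Polynomial ℤ), Literature.NumberTheory.Sieve.IsBatemanHornSystem f → (f 0).natDegree = 1 →
      ∃ A C : ℝ, ∃ x₀ : ℕ, ∀ x : ℕ, x₀ ≤ x → ∀ z : ℂ, ‖z - 1‖ ≤ 3 * Real.log (Real.log (x : ℝ)) →
        ‖(∑ n ∈ Finset.range (x + 1), (z : ℂ) ^ (∑ i, (((f i).eval (n : ℤ)).toNat.factorization.sum fun _ v => min v 2)))‖ ≤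
          A * (x : ℝ) * (Real.log (x : ℝ)) ^ (((1 : ℕ) : ℝ) * ((z : ℂ).re - 1)) *
            Real.exp (C * ‖(z : ℂ) - 1‖ * Real.log (‖(z : ℂ) - 1‖ + 2)) := by
  intro f hf hdeg
  obtain ⟨hf0, ha1, hcop⟩ := linear_data hf hdeg
  set a : ℤ := (f 0).coeff 1 with hadef
  set b : ℤ := (f 0).coeff 0 with hbdef
  by_cases ha : a = 1
  · have hP : f 0 = X + C b := by rw [hf0, ha, map_one, one_mul]
    obtain ⟨A, C', x₀, h⟩ := growingDiscXAdd b
    refine ⟨A, C', x₀, fun x hx z hz => ?_⟩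
    simp_rw [exponent_fin_one f _ hP]
    exact h x hx z hz
  · have ha2 : 2 ≤ a := by omega
    obtain ⟨A, C', x₀, h⟩ := growingDiscLinearAP a b ha2 hcop
    refine ⟨A, C', x₀, fun x hx z hz => ?_⟩
    simp_rw [exponent_fin_one f _ hf0]
    exact h x hx z hz

/-- **The classical class in the crux's own quantifier shape**: `DiscMajorantLog` restricted to systems
with `k = 1`, `deg = 1` (every `(k : ℕ)`-indexed instance with `k = 1`). Together with the `k = 0` row
(`stub_finZero`) this is every Bateman–Horn system with `k ≤ 1`, `deg ≤ 1`.
[cite: MontgomeryVaughan2007, §7.4 Theorems 7.17–7.18 and §11.3] -/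
theorem discMajorantLog_of_linear :
    ∀ (k : ℕ) (f : Fin k → Polynomial ℤ), Literature.NumberTheory.Sieve.IsBatemanHornSystem f →
      k = 1 → (∀ i, (f i).natDegree = 1) →
      ∃ A C : ℝ, ∃ x₀ : ℕ, ∀ x : ℕ, x₀ ≤ x → ∀ z : ℂ, ‖z - 1‖ ≤ 3 * Real.log (Real.log (x : ℝ)) →
        ‖(∑ n ∈ Finset.range (x + 1), (z : ℂ) ^ (∑ i, (((f i).eval (n : ℤ)).toNat.factorization.sum fun _ v => min v 2)))‖ ≤
          A * (x : ℝ) * (Real.log (x : ℝ)) ^ ((k : ℝ) * ((z : ℂ).re - 1)) *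
            Real.exp (C * ‖(z : ℂ) - 1‖ * Real.log (‖(z : ℂ) - 1‖ + 2)) := by
  rintro k f hf rfl hdeg
  exact growingDiscLinear f hf (hdeg 0)

end Summit.Parity.BatemanHorn.Cruxes.DiscMajorantLog.Sketch

end
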